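import Summits.FinalStateConjecture.FinalStateConjecture.Theses.KerrnessPropagates
import Summits.FinalStateConjecture.FinalStateConjecture.Theorems.KerrnessPropagatesKerrBasinCaptureStubDirectionDodging
import Summits.FinalStateConjecture.FinalStateConjecture.Theorems.KerrnessPropagatesKerrBasinCaptureStubLargeNearZones
import Summits.FinalStateConjecture.FinalStateConjecture.Theorems.BartnikGapSettlingGapExhaustionKerrRadiusSublevelConvex

/-!
# Route `KerrnessPropagates`, crux `KerrBasinCapture` (stmt-FinalStateConjecture-17646), line `registered`
# (skeleton `Cruxes/KerrBasinCapture/Lines/birth.lean`, lead rev 5) — stub `stub_flatPathExists`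

**A flat preconnected path to the far zone (C1).** For margins `(N₀, m₀, χ, μ, v₀, L₀)`, a
multi-Kerr configuration `(M, a, r₀, mo)` in the margins and a radius `ρ₁ > 0` there is a late
time `T` such that, for every lab time `τ ≥ T`, every slab point `z ∈ {x⁰ = τ}` whose hole
radii `rᵢ(z) = r_{aᵢ}(Λᵢ⁻¹(z − cᵢ))` are all `≥ ρ₁` lies on a preconnected subset `S` of the
hyperplane `{x⁰ = τ}` on which all hole radii stay `≥ ρ₁`, and `S` contains a point `z₂` with
`rᵢ(z₂) ≥ Rᵢ` for every `i` (`R` arbitrary, `T` independent of `R` and `z`).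

Proof.  Let `Xᵢ(τ)` be the lab position of the centre of hole `i` at lab time `τ` (the lab
worldline point `pᵢ`, `exists_centre`); by strict recession the centres are pairwise
`τ v₀ − 2K₀` apart (`sub_le_norm_centre_sub`).  Two conversions between lab distances and hole
radii on `{x⁰ = τ}` are used: *far in the lab ⇒ large radius*, `Θ + m₀⁻¹ ≤ ‖x~ − Xᵢ‖ ⇒ Θ ≤ rᵢ(x)`
(`le_radius_of_le_norm_spatial_sub`, `|aᵢ| ≤ m₀⁻¹`), and *ray monotonicity*: the lab ray from
`Xₗ(τ)` through `z` inside `{x⁰ = τ}` is mapped by `Λₗ⁻¹(· − pₗ)` onto the ray `t ↦ t • w`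
through `w = Λₗ⁻¹(z − pₗ)`, along which the Kerr–Schild radius is monotone (the solid confocal
ellipsoids `{r < c}` are star-shaped, `kerrSublevel_radius_lt_iff`).  With `ρ̄ = ρ₁ + m₀⁻¹`,
`D = 32 (N + 1) ρ̄` and `τ v₀ ≥ 2K₀ + 4D`:
* SEGMENT 1 — recede from the nearest hole `l` along the lab ray `t ↦ pₗ + t (z − pₗ)`,
  `t ∈ [1, λ₁]`, `λ₁ ‖z~ − Xₗ‖ = max(‖z~ − Xₗ‖, D)`: `r_l` does not decrease, every other hole
  stays `≥ (τ v₀ − 2K₀)/2 − D ≥ D ≥ ρ̄` away, and the endpoint `z₁` is `D`-far from all centres;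
* SEGMENT 2 — from `z₁` follow a dodging ray `s ↦ z₁ + s (0, e)` (`stub_directionDodging`:
  it stays `ρ̄`-far from all centres), long enough that its endpoint `z₂` is
  `|Rᵢ| + m₀⁻¹`-far from every centre.
Both segments are continuous images of intervals sharing `z₁`, hence `S` is preconnected.
For `N = 0` only segment 2 is used. [folklore]
-/

open scoped BigOperators Topology Manifold Classical Matrix InnerProductSpace ContinuousMap
open Filter Set Function TopologicalSpace
open Literature.Geometry.Lorentzian

-- D-0017: single-problem summit, `Summit.<S>.<S>.…` by design.
set_option linter.dupNamespace false

namespace Summit.FinalStateConjecture.FinalStateConjecture.Theorems.KerrnessPropagates.KerrBasinCapture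

open Summit.FinalStateConjecture.FinalStateConjecture.Theorems

/-- **Ray monotonicity of the Kerr–Schild radius**: `s ↦ r_a(s • w)` is monotone on `s ≥ 0`
(the solid confocal ellipsoids `{r < c}`, `c > 0`, are star-shaped about the origin:
`kerrSublevel_radius_lt_iff`). [folklore] -/
theorem kerrRadius_smul_mono (a : ℝ) (w : E4) {s s' : ℝ} (hs : 0 ≤ s) (hss' : s ≤ s') :
    Kerr.radius a (s • w) ≤ Kerr.radius a (s' • w) := by
  by_contra hlt
  push Not at hlt
  obtain ⟨c, hc⟩ : ∃ c : ℝ, c = Kerr.radius a (s • w) := ⟨_, rfl⟩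
  rw [← hc] at hlt
  have hcpos : 0 < c := (Kerr.radius_nonneg a _).trans_lt hlt
  have h1 := (kerrSublevel_radius_lt_iff hcpos (s' • w)).1 hlt
  have h2 : ¬ (Kerr.radius a (s • w) < c) := by rw [← hc]; exact lt_irrefl c
  rw [kerrSublevel_radius_lt_iff hcpos (s • w), not_lt] at h2
  simp only [PiLp.smul_apply, smul_eq_mul] at h1 h2
  have hQ : 0 ≤ c ^ 2 * (w 1 ^ 2 + w 2 ^ 2) + (c ^ 2 + a ^ 2) * w 3 ^ 2 := by positivity
  have hs2 : s ^ 2 ≤ s' ^ 2 := pow_le_pow_left₀ hs hss' 2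
  nlinarith [mul_le_mul_of_nonneg_right hs2 hQ]

/-- stub C1 — **A FLAT PRECONNECTED PATH TO THE FAR ZONE** (registered stub of crux
stmt-FinalStateConjecture-17646, line `registered`): for margins `(N₀, m₀, χ, μ, v₀, L₀)`, a
configuration in the margins and `ρ₁ > 0` there is a late time `T` such that for `τ ≥ T` every
point `z` of the slab `{x⁰ = τ}` with all hole radii `≥ ρ₁` lies on a preconnected subset of the
slab with all hole radii `≥ ρ₁` containing a point with hole radii `≥ Rᵢ` (`R` arbitrary).
Segment 1 recedes from the nearest hole along the lab ray from its centre (= a rest-frame radial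
ray, on which the Kerr–Schild radius is monotone), segment 2 is a dodging ray
(`stub_directionDodging`) past all the other, `≳ τ v₀`-distant, holes. [folklore] -/
theorem stub_flatPathExists : ∀ (N₀ : ℕ) (m₀ χ μ v₀ L₀ : ℝ), 0 < m₀ → χ < 1 → 0 < μ → 0 < v₀ → ∀ (N : ℕ) (M a r₀ : Fin N → ℝ) (mo : Fin N → ↥lorentzGroup × E4), (N ≤ N₀ ∧ (∀ i, m₀ ≤ M i ∧ M i ≤ m₀⁻¹ ∧ |a i| ≤ χ * M i ∧ Kerr.rMinus (M i) (a i) + μ ≤ r₀ i ∧ r₀ i + μ ≤ Kerr.rPlus (M i) (a i) ∧ ∀ v : E4, ‖((mo i).1 : E4 ≃L[ℝ] E4) v‖ ≤ L₀ * ‖v‖) ∧ (∀ i j, i ≠ j → v₀ ≤ ‖(((mo i).1 : E4 ≃L[ℝ] E4) (E4.basisVector 0) 0)⁻¹ • E4.spatial (((mo i).1 : E4 ≃L[ℝ] E4) (E4.basisVector 0)) - (((mo j).1 : E4 ≃L[ℝ] E4) (E4.basisVector 0) 0)⁻¹ • E4.spatial (((mo j).1 : E4 ≃L[ℝ] E4)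 (E4.basisVector 0))‖)) → ∀ ρ₁ : ℝ, 0 < ρ₁ → ∃ T : ℝ, ∀ τ : ℝ, T ≤ τ → ∀ (R : Fin N → ℝ) (z : E4), z 0 = τ → (∀ i, ρ₁ ≤ Kerr.radius (a i) (poincareInv (mo i).1 (mo i).2 z)) → ∃ S : Set E4, IsPreconnected S ∧ z ∈ S ∧ (∀ x ∈ S, x 0 = τ ∧ ∀ i, ρ₁ ≤ Kerr.radius (a i) (poincareInv (mo i).1 (mo i).2 x)) ∧ ∃ z₂ ∈ S, ∀ i, R i ≤ Kerr.radius (a i) (poincareInv (mo i).1 (mo i).2 z₂) := by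
  intro N₀ m₀ χ μ v₀ L₀ hm₀ hχ _hμ hv₀ N M a r₀ mo hconf ρ₁ hρ₁
  obtain ⟨-, hmarg, hsep⟩ := hconf
  have hfacts : ∀ i, 0 < M i ∧ |a i| ≤ m₀⁻¹ ∧ μ ≤ r₀ i := fun i ↦
    margin_facts hm₀ hχ (hmarg i).1 (hmarg i).2.1 (hmarg i).2.2.1 (hmarg i).2.2.2.1
  -- constants depending only on the margins, the configuration and `ρ₁`
  obtain ⟨ρb, hρb⟩ : ∃ ρb : ℝ, ρb = ρ₁ + m₀⁻¹ := ⟨_, rfl⟩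
  have hρbpos : 0 < ρb := by rw [hρb]; positivity
  obtain ⟨D, hD⟩ : ∃ D : ℝ, D = 32 * ((N : ℝ) + 1) * ρb := ⟨_, rfl⟩
  have hρbD : ρb ≤ D := by
    have hN0 : (0 : ℝ) ≤ (N : ℝ) := Nat.cast_nonneg N
    rw [hD]
    nlinarith [mul_nonneg hN0 hρbpos.le]
  have hDnn : 0 ≤ D := hρbpos.le.trans hρbD
  obtain ⟨V, hV⟩ : ∃ V : Fin N → E3, ∀ i, V i = ((((mo i).1 : E4 ≃L[ℝ] E4) (E4.basisVector 0)) 0)⁻¹ •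
      E4.spatial (((mo i).1 : E4 ≃L[ℝ] E4) (E4.basisVector 0)) := ⟨fun i ↦ _, fun i ↦ rfl⟩
  obtain ⟨d, hd⟩ : ∃ d : Fin N → E3, ∀ i, d i = E4.spatial (mo i).2 - ((mo i).2 0) • V i :=
    ⟨fun i ↦ _, fun i ↦ rfl⟩
  obtain ⟨K₀, hK₀⟩ : ∃ K₀ : ℝ, K₀ = ∑ i, ‖d i‖ := ⟨_, rfl⟩
  have hdle : ∀ i, ‖d i‖ ≤ K₀ := fun i ↦ by
    rw [hK₀]
    exact Finset.single_le_sum (fun i _ ↦ norm_nonneg (d i)) (Finset.mem_univ i)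
  have hK₀nn : 0 ≤ K₀ := by
    rw [hK₀]
    exact Finset.sum_nonneg fun i _ ↦ norm_nonneg (d i)
  -- the late time
  refine ⟨(2 * K₀ + 4 * D) / v₀, ?_⟩
  intro τ hτ R z hz0 hz
  have hτv : 2 * K₀ + 4 * D ≤ τ * v₀ := (div_le_iff₀ hv₀).mp hτ
  have hτnn : 0 ≤ τ := le_trans (div_nonneg (by linarith) hv₀.le) hτ
  -- the lab worldline points of all holes at lab time `τ`
  choose p hp0 hpσ hpsp using fun i ↦ exists_centre (mo i).1 (mo i).2 τ
  have hpsp' : ∀ i, E4.spatial (p i) = d i + τ • V i := fun i ↦ by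
    rw [hpsp i, ← hV i, hd i, sub_smul]
    abel
  have hrad : ∀ i (y : E4), Kerr.radius (a i) (poincareInv (mo i).1 (p i) y) =
      Kerr.radius (a i) (poincareInv (mo i).1 (mo i).2 y) := fun i y ↦ by
    obtain ⟨σ, hσ⟩ := hpσ i
    rw [poincareInv_eq_sub (mo i).1 (mo i).2 (p i) y, hσ, sub_eq_add_neg, ← neg_smul,
      Kerr.radius_add_time_smul_basisVector]
  -- strict recession: the centres are pairwise `τ v₀ − 2K₀` apart in the lab
  have hsepij : ∀ i j, i ≠ j → τ * v₀ - 2 * K₀ ≤ ‖E4.spatial (p j) - E4.spatial (p i)‖ := by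
    intro i j hij
    rw [hpsp' j, hpsp' i]
    refine sub_le_norm_centre_sub hτnn ?_ (by linarith [hdle i, hdle j])
    rw [hV j, hV i]
    exact hsep j i (Ne.symm hij)
  -- far in the lab from the centre of hole `i` ⇒ large hole-`i` radius
  have hfar : ∀ i (x : E4) (Θ : ℝ), x 0 = τ → 0 ≤ Θ →
      Θ + m₀⁻¹ ≤ ‖E4.spatial x - E4.spatial (p i)‖ →
      Θ ≤ Kerr.radius (a i) (poincareInv (mo i).1 (mo i).2 x) := by
    intro i x Θ hx0 hΘ hfarx
    rw [← hrad i x]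
    refine le_radius_of_le_norm_spatial_sub (mo i).1 (a i) (x := x) (p := p i)
      (by rw [hx0, hp0 i]) hΘ ?_
    linarith [(hfacts i).2.1]
  -- SEGMENT 2: from a point `D`-far from all the centres a dodging ray reaches the far zone
  have seg2 : ∀ z₁ : E4, z₁ 0 = τ → (∀ i, D ≤ ‖E4.spatial z₁ - E4.spatial (p i)‖) →
      ∃ S : Set E4, IsPreconnected S ∧ z₁ ∈ S ∧
        (∀ x ∈ S, x 0 = τ ∧ ∀ i, ρ₁ ≤ Kerr.radius (a i) (poincareInv (mo i).1 (mo i).2 x)) ∧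
        ∃ z₂ ∈ S, ∀ i, R i ≤ Kerr.radius (a i) (poincareInv (mo i).1 (mo i).2 z₂) := by
    intro z₁ hz₁0 hz₁far
    obtain ⟨e, he1, he⟩ := stub_directionDodging N (fun i ↦ E4.spatial (p i)) (E4.spatial z₁)
      ρb D hρbpos hD.ge hz₁far
    obtain ⟨s₂, hs₂⟩ : ∃ s₂ : ℝ, s₂ = m₀⁻¹ + ∑ j, (|R j| + ‖E4.spatial z₁ - E4.spatial (p j)‖) :=
      ⟨_, rfl⟩
    have hsum : ∀ i, |R i| + ‖E4.spatial z₁ - E4.spatial (p i)‖ ≤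
        ∑ j, (|R j| + ‖E4.spatial z₁ - E4.spatial (p j)‖) := fun i ↦
      Finset.single_le_sum (f := fun j ↦ |R j| + ‖E4.spatial z₁ - E4.spatial (p j)‖)
        (fun j _ ↦ by positivity) (Finset.mem_univ i)
    have hsum0 : 0 ≤ ∑ j, (|R j| + ‖E4.spatial z₁ - E4.spatial (p j)‖) :=
      Finset.sum_nonneg fun j _ ↦ by positivity
    have hs₂nn : 0 ≤ s₂ := by
      rw [hs₂]
      linarith [inv_pos.mpr hm₀]
    have hs₂i : ∀ i, |R i| + ‖E4.spatial z₁ - E4.spatial (p i)‖ + m₀⁻¹ ≤ s₂ := fun i ↦ by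
      rw [hs₂]
      linarith [hsum i]
    obtain ⟨γ, hγ⟩ : ∃ γ : ℝ → E4, ∀ s, γ s = z₁ + s • E4.ofTimeSpace 0 e := ⟨_, fun s ↦ rfl⟩
    have hγ0 : ∀ s, γ s 0 = τ := fun s ↦ by
      rw [hγ]
      simp [hz₁0]
    have hγsp : ∀ s, E4.spatial (γ s) = E4.spatial z₁ + s • e := fun s ↦ by
      rw [hγ, map_add, map_smul, E4.spatial_ofTimeSpace]
    have hγc : Continuous γ := by
      rw [show γ = fun s ↦ z₁ + s • E4.ofTimeSpace 0 e from funext hγ]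
      fun_prop
    refine ⟨γ '' Icc 0 s₂, isPreconnected_Icc.image γ hγc.continuousOn,
      ⟨0, left_mem_Icc.mpr hs₂nn, by rw [hγ]; simp⟩, ?_,
      ⟨γ s₂, mem_image_of_mem γ (right_mem_Icc.mpr hs₂nn), fun i ↦ ?_⟩⟩
    · rintro _ ⟨s, hs, rfl⟩
      refine ⟨hγ0 s, fun i ↦ hfar i (γ s) ρ₁ (hγ0 s) hρ₁.le ?_⟩
      have he' : ρb ≤ ‖E4.spatial z₁ + s • e - E4.spatial (p i)‖ := he i s hs.1
      rw [hγsp s, ← hρb]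
      exact he'
    · refine (le_abs_self (R i)).trans (hfar i (γ s₂) |R i| (hγ0 s₂) (abs_nonneg _) ?_)
      rw [hγsp s₂]
      have h1 : ‖s₂ • e‖ = s₂ := by rw [norm_smul, he1, mul_one, Real.norm_of_nonneg hs₂nn]
      have h2 := norm_le_add_norm_add (s₂ • e) (E4.spatial z₁ - E4.spatial (p i))
      have h3 : s₂ • e + (E4.spatial z₁ - E4.spatial (p i)) =
          E4.spatial z₁ + s₂ • e - E4.spatial (p i) := by abel
      rw [h3] at h2
      linarith [hs₂i i]
  -- no holes: segment 2 alone
  rcases isEmpty_or_nonempty (Fin N) with hN | hN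
  · exact seg2 z hz0 (fun i ↦ hN.elim i)
  -- SEGMENT 1: recede from the nearest hole `l` along the lab ray from its centre through `z`
  obtain ⟨l, -, hl⟩ := Finset.exists_min_image Finset.univ
    (fun i ↦ ‖E4.spatial z - E4.spatial (p i)‖) (Finset.univ_nonempty_iff.mpr hN)
  obtain ⟨δ, hδ⟩ : ∃ δ : ℝ, δ = ‖E4.spatial z - E4.spatial (p l)‖ := ⟨_, rfl⟩
  have hlmin : ∀ i, δ ≤ ‖E4.spatial z - E4.spatial (p i)‖ := fun i ↦ by
    rw [hδ]
    exact hl i (Finset.mem_univ i)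
  -- the other holes are `2D`-far from `z`
  have hother : ∀ i, i ≠ l → 2 * D ≤ ‖E4.spatial z - E4.spatial (p i)‖ := by
    intro i hil
    have h1 := hsepij i l hil
    have h2 := norm_sub_le_norm_sub_add_norm_sub (E4.spatial (p l)) (E4.spatial z) (E4.spatial (p i))
    rw [norm_sub_rev (E4.spatial (p l)) (E4.spatial z), ← hδ] at h2
    linarith [hlmin i]
  -- `z` is not the centre of hole `l`: its hole-`l` radius is positive
  obtain ⟨w, hw⟩ : ∃ w : E4, w = poincareInv (mo l).1 (p l) z := ⟨_, rfl⟩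
  have hwrad : ρ₁ ≤ Kerr.radius (a l) w := by
    rw [hw, hrad]
    exact hz l
  have hδpos : 0 < δ := by
    rcases (norm_nonneg (E4.spatial z - E4.spatial (p l))).lt_or_eq with h | h
    · rwa [hδ]
    · exfalso
      have hzp0 : (z - p l) 0 = 0 := by simp [hz0, hp0 l]
      have hzp : z - p l = 0 := by
        rw [← norm_eq_zero, norm_eq_spatialNorm_of_apply_zero_eq_zero hzp0, E4.spatialNorm,
          map_sub]
        exact h.symm
      have hw0 : w = 0 := by rw [hw, poincareInv, hzp, map_zero]
      have h1 := Kerr.radius_le_spatialNorm (a l) (0 : E4)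
      rw [E4.spatialNorm, map_zero, norm_zero] at h1
      rw [hw0] at hwrad
      linarith
  obtain ⟨lam, hlam⟩ : ∃ lam : ℝ, lam = max 1 (D / δ) := ⟨_, rfl⟩
  have hlam1 : 1 ≤ lam := by
    rw [hlam]
    exact le_max_left _ _
  have hlamδ : lam * δ = max δ D := by
    rw [hlam, max_mul_of_nonneg _ _ hδpos.le, one_mul, div_mul_cancel₀ _ hδpos.ne']
  obtain ⟨γ₁, hγ₁⟩ : ∃ γ₁ : ℝ → E4, ∀ t, γ₁ t = p l + t • (z - p l) := ⟨_, fun t ↦ rfl⟩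
  have hγ₁one : γ₁ 1 = z := by
    rw [hγ₁]
    simp
  have hγ₁0 : ∀ t, γ₁ t 0 = τ := fun t ↦ by
    rw [hγ₁]
    simp [hz0, hp0 l]
  have hγ₁sp : ∀ t, E4.spatial (γ₁ t) =
      E4.spatial (p l) + t • (E4.spatial z - E4.spatial (p l)) := fun t ↦ by
    rw [hγ₁, map_add, map_smul, map_sub]
  have hγ₁inv : ∀ t, poincareInv (mo l).1 (p l) (γ₁ t) = t • w := fun t ↦ by
    rw [hγ₁, hw, poincareInv, poincareInv, add_sub_cancel_left, map_smul]
  have hγ₁c : Continuous γ₁ := by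
    rw [show γ₁ = fun t ↦ p l + t • (z - p l) from funext hγ₁]
    fun_prop
  -- along segment 1 the other holes stay `D`-far
  have hdist : ∀ t ∈ Icc 1 lam, ∀ i, i ≠ l → D ≤ ‖E4.spatial (γ₁ t) - E4.spatial (p i)‖ := by
    intro t ht i hil
    have h1 : E4.spatial (γ₁ t) - E4.spatial (p i) =
        (E4.spatial z - E4.spatial (p i)) + (t - 1) • (E4.spatial z - E4.spatial (p l)) := by
      rw [hγ₁sp t, sub_smul, one_smul]
      abel
    have h2 : ‖(t - 1) • (E4.spatial z - E4.spatial (p l))‖ ≤ D := by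
      rw [norm_smul, Real.norm_of_nonneg (sub_nonneg.mpr ht.1), ← hδ]
      have h3 : (t - 1) * δ ≤ lam * δ - δ := by nlinarith [ht.2, hδpos.le]
      have h4 : max δ D ≤ δ + D := max_le (by linarith) (by linarith [hδpos.le])
      linarith [hlamδ]
    have h3 := norm_le_add_norm_add (E4.spatial z - E4.spatial (p i))
      ((t - 1) • (E4.spatial z - E4.spatial (p l)))
    rw [← h1] at h3
    linarith [hother i hil]
  -- the endpoint of segment 1 is `D`-far from its own hole as well
  have hdistl : D ≤ ‖E4.spatial (γ₁ lam) - E4.spatial (p l)‖ := by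
    rw [hγ₁sp lam, add_sub_cancel_left, norm_smul,
      Real.norm_of_nonneg (zero_le_one.trans hlam1), ← hδ, hlamδ]
    exact le_max_right _ _
  -- radii along segment 1
  have hseg1 : ∀ t ∈ Icc 1 lam, ∀ i,
      ρ₁ ≤ Kerr.radius (a i) (poincareInv (mo i).1 (mo i).2 (γ₁ t)) := by
    intro t ht i
    by_cases hil : i = l
    · rw [hil, ← hrad, hγ₁inv]
      calc ρ₁ ≤ Kerr.radius (a l) w := hwrad
        _ = Kerr.radius (a l) ((1 : ℝ) • w) := by rw [one_smul]
        _ ≤ Kerr.radius (a l) (t • w) := kerrRadius_smul_mono (a l) w zero_le_one ht.1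
    · refine hfar i (γ₁ t) ρ₁ (hγ₁0 t) hρ₁.le ?_
      rw [← hρb]
      exact hρbD.trans (hdist t ht i hil)
  -- glue segment 2 at the endpoint `z₁ = γ₁ λ₁`
  have hlammem : lam ∈ Icc 1 lam := right_mem_Icc.mpr hlam1
  obtain ⟨S₂, hS₂c, hz₁S₂, hS₂, z₂, hz₂, hR⟩ := seg2 (γ₁ lam) (hγ₁0 lam) (fun i ↦ by
    by_cases hil : i = l
    · rw [hil]
      exact hdistl
    · exact hdist lam hlammem i hil)
  refine ⟨γ₁ '' Icc 1 lam ∪ S₂, ?_, Or.inl ⟨1, left_mem_Icc.mpr hlam1, hγ₁one⟩, ?_,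
    z₂, Or.inr hz₂, hR⟩
  · exact IsPreconnected.union (γ₁ lam) (mem_image_of_mem γ₁ hlammem) hz₁S₂
      (isPreconnected_Icc.image γ₁ hγ₁c.continuousOn) hS₂c
  · rintro x (⟨t, ht, rfl⟩ | hx)
    · exact ⟨hγ₁0 t, hseg1 t ht⟩
    · exact hS₂ x hx

end Summit.FinalStateConjecture.FinalStateConjecture.Theorems.KerrnessPropagates.KerrBasinCapture
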